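import Literature.NumberTheory.EllipticCurves.NeronLocalHeightBadPlaces
import Literature.NumberTheory.EllipticCurves.JInvariantDenominator
import Literature.NumberTheory.EllipticCurves.LangHeightEC
import Literature.NumberTheory.EllipticCurves.LangHeightSmallPoints
import Literature.NumberTheory.EllipticCurves.LangHeightECProofs
import Literature.NumberTheory.EllipticCurves.LangHeightNonarchEstimateProofs
import Literature.NumberTheory.EllipticCurves.NeronLocalHeightDecompositionProofs
import Literature.NumberTheory.EllipticCurves.NeronLocalHeightBadPlacesProofs
import Literature.NumberTheory.EllipticCurves.NeronLocalHeightBadPlacesSplitProofs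
import Literature.NumberTheory.EllipticCurves.WeierstrassSigmaQProductProofs
import Mathlib.Combinatorics.Pigeonhole
import HarnessLib

/-!
# Silverman's theorem towards Lang's conjecture over `ℚ` (AEC Thm. VIII.9.10(a)): the assembly

Sibling proof file of `LangHeightEC.lean` / `NeronLocalHeightBadPlaces.lean` (topic
`NumberTheory/EllipticCurves`, family `abc`, G06). It proves the *global* layer of the printed proof
of the named fact `Literature.NumberTheory.EllipticCurves.langHeightLowerBound_of_nu` — Silverman's
theorem (J. H. Silverman, *The Arithmetic of Elliptic Curves*, 2nd ed., Thm. VIII.9.10(a), after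
*Lower bound for the canonical height on elliptic curves*, Duke Math. J. 48 (1981)): for every `ν`
there is `C(ν) > 0` such that `ĥ(P) > C(ν) max{h(j_E), log|Δ_min(E)|, 1}` for all elliptic curves
`E/ℚ` whose `j`-invariant has exactly `ν` primes in its denominator and all non-torsion
`P ∈ E(ℚ)` — as the conditional theorem `langHeightLowerBound_of_nu_of`, whose three hypotheses are
exactly the local-height statements used by the printed argument (AEC prints no proof: "The proof
of (VIII.9.10) is beyond the scope of this book"; the argument is that of Silverman 1981, restated
in Silverman, *Lang's height conjecture and Szpiro's conjecture*, arXiv:0908.3895, proof of Thm. 5,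
where for `J ≥ ν(E)` depleted primes no Fourier averaging is needed):

1. `le_neronLocalHeight_twelve_nsmul_of_not_hasSplitMultiplicativeReductionAt`
   (`NeronLocalHeightBadPlaces.lean`; ATAEC Thm. VI.4.1 with Kodaira–Néron): away from split
   multiplicative reduction `λ_v(12Q) ≥ (1/12) ord_v(Δ_min) log p_v`;
2. `exists_bernoulli_le_neronLocalHeight_of_hasSplitMultiplicativeReductionAt`
   (`NeronLocalHeightBadPlaces.lean`; ATAEC Thm. VI.4.2(b), Tate's uniformisation): at a split
   multiplicative place `λ_v(Q) ≥ ½ 𝐁₂(r_v(Q)) ord_v(Δ_min) log p_v` for a homomorphism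
   `r_v : E(ℚ) → ℝ/ℤ`;
3. `Petsche2006_exists_subset_le_neronLocalHeight_real` (`LangHeightSmallPoints.lean`; the
   archimedean pigeonhole estimate of Hindry–Silverman in Petsche's form, here with `N = 1`): among
   any `24² + 1` rational points two have `λ_∞(P − Q) ≥ (1/288) max{1, log|j_E|}`.

Everything else is proved here or in the tree: the local decomposition `ĥ = 2(λ_∞ + Σ_p λ_p)`
(ATAEC VI.2.1, `canonicalHeight_eq_two_mul_sum_neronLocalHeight_holds`), `log N(𝔇_min) = Σ_p
ord_p(Δ_min) log p` and `N(𝔇_min) = |Δ_min|` (`LangHeightNonarchEstimateProofs`, `EllArithGlueProofs`),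
quadraticity and non-negativity of `ĥ` (`HeightsProofs`), and the three facts about `den(j_E)`
(`JInvariantDenominator.lean`: split multiplicative primes divide `den(j)`, `den(j) ∣ |Δ_min|`,
`h(j) ≤ max{1, log|j|} + log N(𝔇_min)`).

## The proof (Silverman 1981 / 2009, over `ℚ`, `d = 1`, `M = 1`)

Let `P ∈ E(ℚ)` be non-torsion, `E` given by a globally minimal `W`, and `P' = 12P`.

* The primes of split multiplicative reduction divide `den(j_E)`
  (`natGenerator_dvd_den_j_of_hasSplitMultiplicativeReductionAt`), so they form a set `Vs` of
  `s ≤ ν` places.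
* *Pigeonhole* (`exists_multiple_near_zero`): the `577 · 24^s` multiples `mP'`, `0 ≤ m < 577·24^s`,
  are distinct; dividing `(ℝ/ℤ)^{Vs}` into `24^s` boxes (each `r_v` in an interval
  `[i/24, (i+1)/24)`), some box contains `577 = 24² + 1` of them, and by fact 3 two of these,
  `aP' ≠ bP'`, have `λ_∞(aP' − bP') ≥ (1/288) max{1, log|j|}`; being in the same box,
  `𝐁₂(r_v(aP' − bP')) ≥ 1/8` for `v ∈ Vs` (`𝐁₂(d) = d² ∓ d + 1/6 ≥ 1/8` for `|d| ≤ 1/24`,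
  `periodizedBernoulli_two_sub_ge`). Put `Q = (a − b)P' = 12((a−b)P)`, `1 ≤ a − b < 577 · 24^s`.
* *Every finite place*: `λ_v(Q) ≥ (1/16) ord_v(Δ_min) log p_v` — by fact 2 and `𝐁₂ ≥ 1/8` at the
  split places, by fact 1 (`1/12 ≥ 1/16`) elsewhere.
* *Summation* (`max_height_le_canonicalHeight_of_local`): `½ ĥ(Q) = λ_∞(Q) + Σ_p λ_p(Q) ≥
  (1/288) max{1, log|j|} + (1/16) log|Δ_min|`, and `h(j) ≤ max{1, log|j|} + log|Δ_min|` because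
  `den(j) ∣ Δ_min` for a minimal equation (`j = c₄³/Δ`, `logHeight₁_j_le`); hence
  `max{h(j), log|Δ_min|, 1} ≤ 144 ĥ(Q) = 144 (a−b)² ĥ(P') = 144² (a−b)² ĥ(P)`.
* Therefore `ĥ(P) ≥ max{…}/(144² · 577² · 576^ν) > C(ν) max{…}` with
  `C(ν) = 1/(2 · 144² · 577² · 576^ν)`.

## Design notes

* Pure proofs (`--kind proof`), no definitions; namespace = path. The discharge
  `langHeightLowerBound_of_nu_holds` (end of the file) is `langHeightLowerBound_of_nu_of h₁ h₂ h₃` fed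
  with the three discharges `…_holds` of the local facts, which have meanwhile landed in the tree
  (`NeronLocalHeightBadPlacesProofs.lean`, `NeronLocalHeightBadPlacesSplitProofs.lean`,
  `WeierstrassSigmaQProductProofs.lean`).
* The boxes of the pigeonhole are read off the representative in `[0, 1)`
  (`AddCircle.equivIco 1 0`), as functions `Vs → ℕ` in `Fintype.piFinset (fun _ ↦ range 24)`;
  Mathlib's `Finset.exists_le_card_fiber_of_mul_le_card_of_maps_to` is the pigeonhole principle.
* As in `LangHeightECProofs.lean`, multiples `m • P` over `ℚ` are related to `ĥ` through
  `canonicalHeight_nsmul_rat` (the group law elaborated with `ℚ`'s decidable equality).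

## References

* J. H. Silverman, *The Arithmetic of Elliptic Curves*, GTM 106, 2nd ed. (2009), Conj. VIII.9.9 and
  Thm. VIII.9.10(a) (PDF p. 218).
* J. H. Silverman, *Lower bound for the canonical height on elliptic curves*, Duke Math. J. 48
  (1981), 633–648.
* J. H. Silverman, *Lang's height conjecture and Szpiro's conjecture*, New York J. Math. 16 (2010),
  1–12; arXiv:0908.3895, Thm. 5 and its proof (pp. 4–6 of the arXiv version).
* J. H. Silverman, *Advanced Topics in the Arithmetic of Elliptic Curves*, GTM 151 (1994), Cor.
  IV.9.2(d), Thm. VI.2.1, Thm. VI.4.1, Thm. VI.4.2.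
* C. Petsche, *Small rational points on elliptic curves over number fields*, New York J. Math. 12
  (2006), 257–268, proof of Prop. 7 (the archimedean step).
-/

noncomputable section

open scoped Classical

open IsDedekindDomain

namespace Literature.NumberTheory.EllipticCurves



open Rat.HeightOneSpectrum _root_.WeierstrassCurve _root_.WeierstrassCurve.Affine.Point

/-! ### The periodic Bernoulli function near `0` -/

/-- If two points of `ℝ/ℤ`, represented in `[0, 1)`, lie in the same interval
`[i/24, (i+1)/24)`, then `𝐁₂` of their difference is at least `1/8`
(`𝐁₂(d) = d² ∓ d + 1/6 ≥ 1/6 − 1/24` for `|d| ≤ 1/24`). [folklore] -/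
theorem periodizedBernoulli_two_sub_ge {s t : ℝ} (hs : s ∈ Set.Ico (0 : ℝ) 1)
    (ht : t ∈ Set.Ico (0 : ℝ) 1) (h : ⌊24 * s⌋₊ = ⌊24 * t⌋₊) :
    1 / 8 ≤ periodizedBernoulli 2 ((s : UnitAddCircle) - (t : UnitAddCircle)) := by
  have hs24 := Nat.floor_eq_iff (by linarith [hs.1] : 0 ≤ 24 * s) |>.mp rfl
  have ht24 := Nat.floor_eq_iff (by linarith [ht.1] : 0 ≤ 24 * t) |>.mp h.symm
  have hd1 : s - t < 1 / 24 := by linarith [hs24.2, ht24.1]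
  have hd2 : t - s < 1 / 24 := by linarith [ht24.2, hs24.1]
  rw [← AddCircle.coe_sub]
  rcases le_or_gt t s with hts | hts
  · rw [periodizedBernoulli_two_coe (by linarith) (by linarith [hs.2, ht.1])]
    nlinarith [sq_nonneg (s - t)]
  · have : ((s - t : ℝ) : UnitAddCircle) = ((s - t + 1 : ℝ) : UnitAddCircle) := by
      rw [AddCircle.coe_add, AddCircle.coe_period, add_zero]
    rw [this, periodizedBernoulli_two_coe (by linarith) (by linarith)]
    nlinarith [sq_nonneg (s - t)]

/-! ### From the place-by-place bounds to `max{h(j), log|Δ_min|, 1} ≤ 144 ĥ(Q)` -/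

section Assembly

variable {W : WeierstrassCurve ℚ} [W.IsElliptic]

/-- **Summation over the places** (Silverman 2009, proof of Thm. 5, the display
"`h_E(mkP) = Σ_{v ∈ M_K^0} … + Σ_{v ∈ M_K^∞} …`", specialised to `K = ℚ` and one good multiple `Q`):
if `λ_v(Q) ≥ (1/16) ord_v(Δ_min) log p_v` at every finite place and
`λ_∞(Q) ≥ (1/288) max{1, log|j|}`, then by the local decomposition `ĥ = 2(λ_∞ + Σ_v λ_v)`
(ATAEC VI.2.1, proved in `NeronLocalHeightDecompositionProofs`), `log N(𝔇_min) = Σ_v ord_v(Δ_min) log p_v`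
and `h(j) ≤ max{1, log|j|} + log N(𝔇_min)` (`logHeight₁_j_le`),
`max{h(j), log|Δ_min|, 1} ≤ 144 ĥ(Q)`. [cite: Silverman2009LangSzpiro, proof of Thm 5] -/
theorem max_height_le_canonicalHeight_of_local [W.IsGloballyMinimal] {Q : W.toAffine.Point}
    (hQ : Q ≠ 0)
    (hfin : ∀ v : HeightOneSpectrum ℤ,
      1 / 16 * ((W.ordMinimalDiscriminant v : ℝ) * Real.log (natGenerator v)) ≤
        Q.neronLocalHeight (padicAbv v))
    (harch : 1 / 288 * max 1 (Real.log |((W.j : ℚ) : ℝ)|) ≤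
      Q.neronLocalHeight Rat.AbsoluteValue.real) :
    max (max (Height.logHeight₁ W.j) (Real.log |(W.minimalDiscriminantInt : ℝ)|)) 1 ≤
      144 * Q.canonicalHeight := by
  obtain ⟨hsupp, hdec⟩ := canonicalHeight_eq_two_mul_sum_neronLocalHeight_holds W Q hQ
  set Fs := hsupp.toFinset with hFs_def
  have hsum : ∑ᶠ v : HeightOneSpectrum ℤ, Q.neronLocalHeight (padicAbv v) =
      ∑ v ∈ Fs, Q.neronLocalHeight (padicAbv v) := finsum_eq_sum _ hsupp
  have hFs : ∀ v, W.ordMinimalDiscriminant v ≠ 0 → v ∈ Fs := by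
    intro v hv
    rw [hFs_def, Set.Finite.mem_toFinset, Function.mem_support]
    have h1 : (1 : ℝ) ≤ W.ordMinimalDiscriminant v := by
      exact_mod_cast Nat.one_le_iff_ne_zero.mpr hv
    have h2 : 0 < Real.log (natGenerator v) :=
      Real.log_pos (by exact_mod_cast (prime_natGenerator v).one_lt)
    have h3 := hfin v
    intro h0
    rw [h0] at h3
    nlinarith
  have hlogN := log_minimalDiscriminantNorm_eq_sum W hFs
  have hnonarch : 1 / 16 * Real.log (W.minimalDiscriminantNorm ℤ : ℝ) ≤
      ∑ v ∈ Fs, Q.neronLocalHeight (padicAbv v) := by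
    rw [hlogN, Finset.mul_sum]
    exact Finset.sum_le_sum fun v _ => hfin v
  have hbridge : |(minimalDiscriminantInt W : ℝ)| = (W.minimalDiscriminantNorm ℤ : ℝ) := by
    rw [minimalDiscriminantNorm_int_eq_natAbs_minimalDiscriminantInt_holds W, Nat.cast_natAbs,
      Int.cast_abs]
  have hN0 : 0 ≤ Real.log (W.minimalDiscriminantNorm ℤ : ℝ) :=
    Real.log_nonneg (by exact_mod_cast minimalDiscriminantNorm_pos_holds W)
  have hj := logHeight₁_j_le W
  have h1 : (1 : ℝ) ≤ max 1 (Real.log |((W.j : ℚ) : ℝ)|) := le_max_left _ _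
  rw [hbridge]
  refine max_le (max_le ?_ ?_) ?_ <;> nlinarith [hdec, hsum]

end Assembly

/-! ### The pigeonhole argument -/

section Pigeonhole

variable {W : WeierstrassCurve ℚ} [W.IsElliptic]

/-- **The pigeonhole step** (Silverman, Duke Math. J. 48 (1981); Silverman 2009, proof of Thm. 5:
*"Using a pigeon-hole principle argument … we can find an integer `k` with `1 ≤ k ≤ (6M)^{J+d}`
such that …"*), over `ℚ` with `M = 1` and the archimedean place handled by Petsche's form of
Hindry–Silverman's lemma (`Petsche2006_exists_subset_le_neronLocalHeight_real` with `N = 1`): given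
homomorphisms `r_v : E(ℚ) → ℝ/ℤ` at the places of a finite set `Vs` and a non-torsion point `P'`,
among the `577 · 24^{|Vs|}` multiples `mP'`, `0 ≤ m < 577 · 24^{|Vs|}`, some `577 = 24² + 1` have all
their `r_v`, `v ∈ Vs`, in the same intervals `[i_v/24, (i_v+1)/24)` (pigeonhole), and two of these,
`aP' ≠ bP'`, satisfy `λ_∞(aP' − bP') ≥ (1/288) max{1, log|j|}`; then also
`𝐁₂(r_v(aP' − bP')) ≥ 1/8` for all `v ∈ Vs`. [cite: Silverman2009LangSzpiro, proof of Thm 5] -/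
theorem exists_multiple_near_zero (h3 : Petsche2006_exists_subset_le_neronLocalHeight_real)
    (r : HeightOneSpectrum ℤ → (W.toAffine.Point →+ UnitAddCircle))
    (Vs : Finset (HeightOneSpectrum ℤ)) {P' : W.toAffine.Point} (hP' : ¬ IsOfFinAddOrder P') :
    ∃ a b : ℕ, b < a ∧ a < 577 * 24 ^ Vs.card ∧
      (∀ v ∈ Vs, 1 / 8 ≤ periodizedBernoulli 2 (r v (a • P' - b • P'))) ∧
      1 / 288 * max 1 (Real.log |((W.j : ℚ) : ℝ)|) ≤
        (a • P' - b • P').neronLocalHeight Rat.AbsoluteValue.real := by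
  set M : ℕ := 577 * 24 ^ Vs.card with hM
  -- the box of a point: the intervals `[i/24, (i+1)/24)` containing `r_v(Q)`, `v ∈ Vs`
  set box : W.toAffine.Point → (↥Vs → ℕ) := fun Q v =>
    ⌊24 * ((AddCircle.equivIco (1 : ℝ) 0 (r v.1 Q) : ℝ))⌋₊ with hbox
  set t : Finset (↥Vs → ℕ) := Fintype.piFinset fun _ => Finset.range 24 with ht
  have htcard : t.card = 24 ^ Vs.card := by
    rw [ht, Fintype.card_piFinset, Finset.prod_const, Finset.card_range, Finset.card_univ,
      Fintype.card_coe]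
  have htne : t.Nonempty := by
    rw [← Finset.card_pos, htcard]
    positivity
  have hmaps : ∀ Q : W.toAffine.Point, box Q ∈ t := by
    intro Q
    rw [ht, Fintype.mem_piFinset]
    intro v
    rw [Finset.mem_range]
    have h1 := (AddCircle.equivIco (1 : ℝ) 0 (r v.1 Q)).2.1
    have h2 := (AddCircle.equivIco (1 : ℝ) 0 (r v.1 Q)).2.2
    simp only [zero_add] at h2
    refine (Nat.floor_lt (by linarith)).mpr ?_
    push_cast
    linarith
  -- the multiples `m P'`, `m < M`, are `M` distinct points
  have hinj : Function.Injective fun m : ℕ => m • P' :=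
    injective_nsmul_iff_not_isOfFinAddOrder.mpr hP'
  set s : Finset W.toAffine.Point := (Finset.range M).image fun m : ℕ => m • P' with hs
  have hscard : s.card = M := by
    rw [hs, Finset.card_image_of_injective _ hinj, Finset.card_range]
  -- pigeonhole: `577` of them in one box
  obtain ⟨y, -, hy⟩ := Finset.exists_le_card_fiber_of_mul_le_card_of_maps_to
    (fun Q _ => hmaps Q) htne (n := 577) (by rw [htcard, hscard, hM]; ring_nf; rfl)
  set S : Finset W.toAffine.Point := s.filter fun Q => box Q = y with hS
  -- two of them with a good archimedean difference
  obtain ⟨Z, hZS, hZcard, hZ⟩ := h3 W S 1 (by norm_num; exact hy)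
  obtain ⟨A, B, hAB, rfl⟩ := Finset.card_eq_two.mp hZcard
  have hA : A ∈ S := hZS (by simp)
  have hB : B ∈ S := hZS (by simp)
  -- same box ⟹ `𝐁₂(r_v(A − B)) ≥ 1/8` for `v ∈ Vs`
  have key : ∀ A ∈ S, ∀ B ∈ S, ∀ v ∈ Vs, 1 / 8 ≤ periodizedBernoulli 2 (r v (A - B)) := by
    intro A hA B hB v hv
    have hbA := (Finset.mem_filter.mp hA).2
    have hbB := (Finset.mem_filter.mp hB).2
    have hAB : box A ⟨v, hv⟩ = box B ⟨v, hv⟩ := by rw [hbA, hbB]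
    simp only [hbox] at hAB
    rw [map_sub, ← AddCircle.coe_equivIco (p := (1 : ℝ)) (a := 0) (y := r v A),
      ← AddCircle.coe_equivIco (p := (1 : ℝ)) (a := 0) (y := r v B)]
    refine periodizedBernoulli_two_sub_ge ?_ ?_ hAB
    · simpa using (AddCircle.equivIco (1 : ℝ) 0 (r v A)).2
    · simpa using (AddCircle.equivIco (1 : ℝ) 0 (r v B)).2
  -- `A = a P'`, `B = b P'` with `a ≠ b` below `M`
  obtain ⟨a, ha, rfl⟩ := Finset.mem_image.mp (Finset.mem_filter.mp hA).1
  obtain ⟨b, hb, rfl⟩ := Finset.mem_image.mp (Finset.mem_filter.mp hB).1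
  have hab : a ≠ b := fun h => hAB (by rw [h])
  rw [Finset.mem_range] at ha hb
  rcases Nat.lt_or_gt_of_ne hab with hlt | hgt
  · exact ⟨b, a, hlt, hb, key _ hB _ hA, hZ _ (by simp) _ (by simp) hAB.symm⟩
  · exact ⟨a, b, hgt, ha, key _ hA _ hB, hZ _ (by simp) _ (by simp) hAB⟩

end Pigeonhole

/-! ### Silverman's theorem over `ℚ` from the three local facts -/

/-- **Silverman's theorem towards Lang's conjecture over `ℚ`** (`langHeightLowerBound_of_nu`;
Silverman, AEC 2nd ed., Thm. VIII.9.10(a), after Duke Math. J. 48 (1981)): for every `ν` there is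
`C(ν) > 0` with `ĥ(P) > C(ν) max{h(j_E), log|Δ_min(E)|, 1}` for all `E/ℚ` with `ν(E) = ν` and all
non-torsion `P ∈ E(ℚ)` — **conditional on the three local-height facts** of its printed proof
(Silverman 1981; Silverman, arXiv:0908.3895, proof of Thm. 5 with `J ≥ ν(E)`, where no Fourier
averaging is needed): the `E₀`-bound away from split multiplicative reduction
(`le_neronLocalHeight_twelve_nsmul_of_not_hasSplitMultiplicativeReductionAt`, ATAEC VI.4.1 with
Kodaira–Néron), Tate's `B₂`-formula at the split multiplicative places
(`exists_bernoulli_le_neronLocalHeight_of_hasSplitMultiplicativeReductionAt`, ATAEC VI.4.2(b)) and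
the archimedean pigeonhole estimate in Petsche's form
(`Petsche2006_exists_subset_le_neronLocalHeight_real`, Hindry–Silverman's Lemma). Proof: replace
`P` by `P' = 12P`; the split multiplicative primes divide `den(j_E)`, so there are `s ≤ ν` of them;
by the pigeonhole step (`exists_multiple_near_zero`) some `Q = kP'`, `1 ≤ k < 577 · 24^s`, has
`λ_∞(Q) ≥ (1/288) max{1, log|j|}` and `𝐁₂(r_v(Q)) ≥ 1/8` at the split places, hence
`λ_v(Q) ≥ (1/16) ord_v(Δ_min) log p_v` at every finite place (the two local facts, `Q = 12(kP)`);
summing (`max_height_le_canonicalHeight_of_local`, ATAEC VI.2.1) gives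
`max{h(j), log|Δ_min|, 1} ≤ 144 ĥ(Q) = 144 · 144 k² ĥ(P)`, so
`C(ν) = 1/(2 · 144² · 577² · 576^ν)` works. The local decomposition ATAEC VI.2.1 and everything
else are proved in the tree. [cite: SilvermanAEC2009, Thm VIII.9.10(a)]
[cite: Silverman2009LangSzpiro, proof of Thm 5] -/
theorem langHeightLowerBound_of_nu_of
    (h1 : le_neronLocalHeight_twelve_nsmul_of_not_hasSplitMultiplicativeReductionAt)
    (h2 : exists_bernoulli_le_neronLocalHeight_of_hasSplitMultiplicativeReductionAt)
    (h3 : Petsche2006_exists_subset_le_neronLocalHeight_real) :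
    langHeightLowerBound_of_nu := by
  intro ν
  set M' : ℝ := 577 * 24 ^ ν with hM'
  refine ⟨1 / (2 * 144 ^ 2 * M' ^ 2), by positivity, ?_⟩
  intro W _ _ hν P hP
  -- the split multiplicative places, at most `ν` of them
  set T : Finset ℕ := (W.j).den.primeFactors with hT
  set g : {p // p ∈ T} → HeightOneSpectrum ℤ := fun p =>
    (primesEquiv (R := ℤ)).symm ⟨p.1, Nat.prime_of_mem_primeFactors p.2⟩ with hg
  set Vs : Finset (HeightOneSpectrum ℤ) :=
    (T.attach.image g).filter fun v => W.HasSplitMultiplicativeReductionAt v with hVs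
  have hVsν : Vs.card ≤ ν := by
    calc Vs.card ≤ (T.attach.image g).card := Finset.card_filter_le _ _
      _ ≤ T.attach.card := Finset.card_image_le
      _ = ν := by rw [Finset.card_attach, hν]
  have hmemVs : ∀ v, W.HasSplitMultiplicativeReductionAt v → v ∈ Vs := by
    intro v hv
    rw [hVs, Finset.mem_filter]
    refine ⟨Finset.mem_image.mpr ?_, hv⟩
    have hp : natGenerator v ∈ T := by
      rw [hT, Nat.mem_primeFactors]
      exact ⟨prime_natGenerator v, natGenerator_dvd_den_j_of_hasSplitMultiplicativeReductionAt W hv,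
        (W.j).den_nz⟩
    refine ⟨⟨natGenerator v, hp⟩, Finset.mem_attach _ _, ?_⟩
    rw [hg]
    exact (primesEquiv (R := ℤ)).symm_apply_apply v
  -- the homomorphisms `r_v` at the split places (zero elsewhere)
  set r : HeightOneSpectrum ℤ → (W.toAffine.Point →+ UnitAddCircle) := fun v =>
    if hv : W.HasSplitMultiplicativeReductionAt v then Classical.choose (h2 W v hv) else 0 with hr
  have hrspec : ∀ v (hv : W.HasSplitMultiplicativeReductionAt v) (Q : W.toAffine.Point), Q ≠ 0 →
      1 / 2 * periodizedBernoulli 2 (r v Q) *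
          ((W.ordMinimalDiscriminant v : ℝ) * Real.log (natGenerator v)) ≤
        Q.neronLocalHeight (padicAbv v) := by
    intro v hv Q hQ
    have := Classical.choose_spec (h2 W v hv) Q hQ
    simp only [hr, hv, dif_pos]
    exact this
  -- `P' = 12 P` and the pigeonhole
  set P' : W.toAffine.Point := (12 : ℕ) • P with hP'def
  have hP' : ¬ IsOfFinAddOrder P' := fun h => hP (h.of_nsmul (by norm_num))
  obtain ⟨a, b, hba, haM, hbox, harch⟩ := exists_multiple_near_zero h3 r Vs hP'
  set k : ℕ := a - b with hk
  have hk0 : k ≠ 0 := by omega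
  have hkM : k < 577 * 24 ^ Vs.card := by omega
  have hQk : a • P' - b • P' = k • P' := (sub_nsmul P' hba.le).symm
  rw [hQk] at hbox harch
  set Q : W.toAffine.Point := k • P' with hQdef
  have hQ0 : Q ≠ 0 := by
    intro h0
    have hinj : Function.Injective fun m : ℕ => m • P' :=
      injective_nsmul_iff_not_isOfFinAddOrder.mpr hP'
    exact hk0 (hinj (show k • P' = 0 • P' by rw [zero_nsmul, ← hQdef, h0]))
  have hQ12 : Q = (12 : ℕ) • (k • P) := by
    rw [hQdef, hP'def, smul_smul, smul_smul, mul_comm]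
  -- the bound at every finite place
  have hfin : ∀ v : HeightOneSpectrum ℤ,
      1 / 16 * ((W.ordMinimalDiscriminant v : ℝ) * Real.log (natGenerator v)) ≤
        Q.neronLocalHeight (padicAbv v) := by
    intro v
    have hδ : 0 ≤ (W.ordMinimalDiscriminant v : ℝ) * Real.log (natGenerator v) :=
      mul_nonneg (Nat.cast_nonneg _)
        (Real.log_nonneg (by exact_mod_cast (prime_natGenerator v).one_lt.le))
    by_cases hv : W.HasSplitMultiplicativeReductionAt v
    · have hB := hbox v (hmemVs v hv)
      have hs := hrspec v hv Q hQ0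
      nlinarith
    · have h12 : (12 : ℕ) • (k • P) ≠ 0 := hQ12 ▸ hQ0
      have := h1 W v hv (k • P) h12
      rw [← hQ12] at this
      linarith
  -- summation and the height of `P`
  have hmax := max_height_le_canonicalHeight_of_local hQ0 hfin harch
  have hQP : Q.canonicalHeight = (k : ℝ) ^ 2 * (144 * P.canonicalHeight) := by
    rw [hQdef, canonicalHeight_nsmul_rat, hP'def, canonicalHeight_nsmul_rat]
    norm_num
  have h0 : 0 ≤ P.canonicalHeight := canonicalHeight_nonneg_holds P
  have hkM' : (k : ℝ) ≤ M' := by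
    have h24 : (24 : ℝ) ^ Vs.card ≤ 24 ^ ν := pow_le_pow_right₀ (by norm_num) hVsν
    have : (k : ℝ) ≤ 577 * 24 ^ Vs.card := by exact_mod_cast hkM.le
    rw [hM']
    linarith
  have hk2 : (k : ℝ) ^ 2 ≤ M' ^ 2 := by gcongr
  set X := max (max (Height.logHeight₁ W.j) (Real.log |(W.minimalDiscriminantInt : ℝ)|)) 1
    with hX
  have hX1 : 1 ≤ X := le_max_right _ _
  have hXle : X ≤ 144 ^ 2 * M' ^ 2 * P.canonicalHeight := by
    calc X ≤ 144 * Q.canonicalHeight := hmax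
      _ = 144 ^ 2 * (k : ℝ) ^ 2 * P.canonicalHeight := by rw [hQP]; ring
      _ ≤ 144 ^ 2 * M' ^ 2 * P.canonicalHeight := by gcongr
  have hM'pos : 0 < M' := by positivity
  have hPpos : 0 < P.canonicalHeight := by
    by_contra hle
    push Not at hle
    have : P.canonicalHeight = 0 := le_antisymm hle h0
    rw [this, mul_zero] at hXle
    linarith
  rw [div_mul_eq_mul_div, one_mul, div_lt_iff₀ (by positivity)]
  nlinarith


/-! ### The discharge -/

/-- **Discharge of `langHeightLowerBound_of_nu`** — Silverman's theorem towards Lang's conjecture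
over `ℚ` (Silverman, AEC 2nd ed., Thm. VIII.9.10(a), after Duke Math. J. 48 (1981)): for every `ν`
there is `C(ν) > 0` with `ĥ(P) > C(ν) max{h(j_E), log|Δ_min(E)|, 1}` for all `E/ℚ` whose
`j`-invariant has `ν` primes in its denominator and all non-torsion `P ∈ E(ℚ)`. It is the assembly
`langHeightLowerBound_of_nu_of` applied to the three discharged local-height facts: the `E₀`-bound
away from split multiplicative reduction
(`le_neronLocalHeight_twelve_nsmul_of_not_hasSplitMultiplicativeReductionAt_holds`, ATAEC VI.4.1
with Kodaira–Néron), Tate's `B₂`-formula at the split multiplicative places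
(`exists_bernoulli_le_neronLocalHeight_of_hasSplitMultiplicativeReductionAt_holds`, ATAEC VI.4.2(b))
and the archimedean step
(`Petsche2006_exists_subset_le_neronLocalHeight_real_holds`, ATAEC VI.3.4 with Hindry–Silverman's
Lemma 5). [cite: SilvermanAEC2009, Thm VIII.9.10(a)] -/
theorem langHeightLowerBound_of_nu_holds : langHeightLowerBound_of_nu :=
  langHeightLowerBound_of_nu_of
    le_neronLocalHeight_twelve_nsmul_of_not_hasSplitMultiplicativeReductionAt_holds
    exists_bernoulli_le_neronLocalHeight_of_hasSplitMultiplicativeReductionAt_holds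
    Petsche2006_exists_subset_le_neronLocalHeight_real_holds

/-- **Lang's conjecture for integral `j`-invariant, unconditionally** (Lang 1983, §1: "This
conjecture was proved by Silverman when the `j`-invariant is an integer"): the corollary
`langHeightLowerBound_of_j_den_eq_one` of `LangHeightEC.lean` fed with the discharge.
[cite: Lang1983CDE, §1 Conj. 2 (remark)] -/
theorem langHeightLowerBound_of_j_den_eq_one_holds :
    ∃ c : ℝ, 0 < c ∧ ∀ (W : WeierstrassCurve ℚ) [W.IsElliptic] [W.IsGloballyMinimal],
      (W.j).den = 1 → ∀ P : W.toAffine.Point, ¬ IsOfFinAddOrder P →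
        c * Real.log |(W.minimalDiscriminantInt : ℝ)| ≤ P.canonicalHeight :=
  langHeightLowerBound_of_j_den_eq_one langHeightLowerBound_of_nu_holds

end Literature.NumberTheory.EllipticCurves

end
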